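import Mathlib
import Literature.NumberTheory.Transcendental.SchanuelEclEmptyProofs
import Literature.Barriers.Schanuel.AlgebraicIndependenceOfLogarithms
import Summits.Schanuel.Schanuel.Theorems.AclSubsetLogFreeCore.Negative.LogFreeCoreObjects
import Summits.Schanuel.Schanuel.Theorems.RigidCoreDefs

/-!
# Calibration of stub B of line `generic-period-fibre` (crux `RigidCore.SchanuelOnLogFreeCore`)

Crux `stmt-Schanuel-0970` (`Summit.Schanuel.Schanuel.Theses.RigidCore.SchanuelOnLogFreeCore`:
Schanuel's conjecture on the log-free core `C_EA`), line `generic-period-fibre`, which splits the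
crux as `A ∧ B ⟹ crux`.  Stub B (`stub_periodGenericOverCore`) is RELATIVE SCHANUEL of the log-free
core `C_EA = logFreeCore = sInf {K ≤ ℂ | 2πi ∈ K, K exp-closed, K relatively algebraically closed}`
over the KERNEL-FREE CORE `M = kernelFreeCore = sInf {K ≤ ℂ | K exp-closed, K r.a.c.}`
(`RigidCoreDefs.lean`): tuples `x ⊂ C_EA` that are `ℚ`-linearly independent MODULO `M` satisfy
`n ≤ trdeg_M M(x, eˣ)`.  It has the shape of Kirby's PROVED relative Schanuel theorem over `ecl ∅`
(J. Kirby, *Exponential algebraicity in exponential fields*, Bull. LMS 42 (2010), arXiv:0810.4285,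
Thm 1.2) with the base shrunk to `M`; the line proves the same statement at every GENERIC fibre
(`stub_genericFibre`, landed), and the kernel fibre `ω = 2πi` is the residue — an OPEN
sub-conjecture of Schanuel's conjecture.  This file CALIBRATES stub B (it records, kernel-checked,
exactly where B stops) and credits nothing towards the crux:

* `CalibrationB.logFreeCore_eq_kernelFreeCore_iff` — **`C_EA = M ⟺ π ∈ M`** (`2, i ∈ M`).
* `CalibrationB.periodGenericOverCore_of_pi_mem` = **`stub_calibB_vacuous`** (registered stub,
  signature verbatim) — if `π ∈ M`, stub B HOLDS VACUOUSLY: every tuple from `C_EA = M` dies modulo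
  `span_ℚ M = M`, so independence modulo `M` forces `n = 0`.  Hence B has content exactly when
  `π ∉ M` — itself open, implied by Schanuel's conjecture (and by stub A).
* `CalibrationB.periodGenericOverCore_rank_le_one` — stub B in rank `n ≤ 1` is bookkeeping (an
  element independent modulo `M` lies outside the relatively algebraically closed field `M`, hence
  is transcendental over `M`).
* `CalibrationB.algebraicIndependent_two_pi_I_exp_of_periodGenericOverCore` and
  `CalibrationB.transcendental_exp_pi_sq_of_periodGenericOverCore` = **`stub_calibB_expPiSq`**
  (registered stub, signature verbatim) — B ∧ `π ∉ M`, at the test tuple `(2πi, (2πi)²) ⊂ C_EA`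
  (independent modulo `M`: a non-trivial rational combination in `M` would make `2πi` algebraic
  over `M`), makes `2πi, e^{−4π²}` ALGEBRAICALLY INDEPENDENT over `M ⊇ ℚ̄`, whence
  `e^{π²} = (e^{−4π²})^{−1/4}` is TRANSCENDENTAL — printed OPEN (M. Waldschmidt, *Diophantine
  Approximation on Linear Algebraic Groups*, Springer (2000), §1.4; tree
  `Literature.Barriers.Schanuel.transcendental_exp_pi_sq_of_schanuel`, consequent open).

`SchanuelConjecture ⟹ B` is kernel-checked separately in the item evidence file
`stub_periodGenericOverCore_schanuel.lean` (658 lines, not landed: hull lemma for `M`, Schanuel at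
`(basis of the hull, x)`, tower law, descent).  All auxiliary results live in the sub-namespace
`Summit.Schanuel.Schanuel.Theorems.RigidCore.CalibrationB` (stated with the named objects
`kernelFreeCore`, `logFreeCore`, which are the stubs' `sInf`s by `rfl`); only the registered stubs
`stub_calibB_vacuous`, `stub_calibB_expPiSq` are declared directly in `…Theorems.RigidCore`.

Sources: Kirby arXiv:0810.4285 Thm 1.2; M. Bays, J. Kirby, *Pseudo-exponential maps, variants,
and quasiminimality*, Algebra Number Theory 12 (2018), arXiv:1512.04262, §9.2; Waldschmidt 2000
§1.4; glue from the tree (`Literature.Barriers.Schanuel.algebraicIndependent_of_le_trdeg_adjoin`)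
and the Negative library (`logFreeCore`, `two_pi_I_mem_logFreeCore`, `logFreeCore_le_of_mem`).
-/

noncomputable section

namespace Summit.Schanuel.Schanuel.Theorems.RigidCore

open Complex IntermediateField
open Literature.NumberTheory.Transcendental
open Summit.Schanuel.Schanuel.Theorems.AclSubsetLogFreeCore.Negative

namespace CalibrationB

/-! ## The kernel-free core `M = kernelFreeCore` inside the log-free core `C_EA = logFreeCore` -/

/-- `i` is algebraic (`i² = −1`). -/
theorem isAlgebraic_I : IsAlgebraic ℚ I :=
  IsAlgebraic.of_pow two_pos (by rw [Complex.I_sq]; exact isAlgebraic_one.neg)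

/-- `i ∈ M`. -/
theorem I_mem_kernelFreeCore : I ∈ kernelFreeCore :=
  mem_kernelFreeCore_of_isAlgebraic_rat isAlgebraic_I

/-- `span_ℚ M = M`: membership in the `ℚ`-span of `M` is membership in `M`. -/
theorem mem_of_mem_span_kernelFreeCore {a : ℂ}
    (ha : a ∈ Submodule.span ℚ (kernelFreeCore : Set ℂ)) : a ∈ kernelFreeCore := by
  have h : Submodule.span ℚ (kernelFreeCore : Set ℂ) ≤
      Subalgebra.toSubmodule kernelFreeCore.toSubalgebra :=
    Submodule.span_le.mpr fun x hx => hx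
  exact h ha

/-- The quotient map modulo `span_ℚ M` kills exactly `M`. -/
theorem mkQ_eq_zero_iff {a : ℂ} :
    (Submodule.span ℚ (kernelFreeCore : Set ℂ)).mkQ a = 0 ↔ a ∈ kernelFreeCore := by
  rw [Submodule.mkQ_apply, Submodule.Quotient.mk_eq_zero]
  exact ⟨mem_of_mem_span_kernelFreeCore, fun h => Submodule.subset_span h⟩

/-- `M ≤ C_EA`. -/
theorem kernelFreeCore_le_logFreeCore : kernelFreeCore ≤ logFreeCore :=
  sInf_le ⟨logFreeCore_mem_coreFamily.2.1, logFreeCore_mem_coreFamily.2.2⟩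

/-- `2 ∈ M`. -/
theorem two_mem_kernelFreeCore : (2 : ℂ) ∈ kernelFreeCore := by
  have h := kernelFreeCore.algebraMap_mem (2 : ℚ)
  rwa [map_ofNat] at h

/-- `π ∈ M ⟺ 2πi ∈ M` (`2, i ∈ M` are units). -/
theorem pi_mem_kernelFreeCore_iff :
    (Real.pi : ℂ) ∈ kernelFreeCore ↔ (2 * ↑Real.pi * I : ℂ) ∈ kernelFreeCore := by
  constructor
  · intro h
    exact mul_mem (mul_mem two_mem_kernelFreeCore h) I_mem_kernelFreeCore
  · intro h
    have hπ : (Real.pi : ℂ) = 2 * ↑Real.pi * I / (2 * I) := by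
      field_simp [Complex.I_ne_zero]
    rw [hπ]
    exact div_mem h (mul_mem two_mem_kernelFreeCore I_mem_kernelFreeCore)

/-- **`C_EA = M ⟺ π ∈ M`**: the log-free core collapses onto the kernel-free core exactly when
the period is log-free constructible; otherwise `M < C_EA` and stub B has content. -/
theorem logFreeCore_eq_kernelFreeCore_iff :
    logFreeCore = kernelFreeCore ↔ (Real.pi : ℂ) ∈ kernelFreeCore := by
  constructor
  · intro h
    rw [pi_mem_kernelFreeCore_iff, ← h]
    exact two_pi_I_mem_logFreeCore
  · intro h
    refine le_antisymm (logFreeCore_le_of_mem ?_) kernelFreeCore_le_logFreeCore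
    exact ⟨pi_mem_kernelFreeCore_iff.mp h, fun _ hw => exp_mem_kernelFreeCore hw,
      fun _ hw => mem_kernelFreeCore_of_isAlgebraic hw⟩

/-! ## (a) Vacuity: if `π ∈ M` then stub B holds trivially -/

/-- **If `π ∈ M`, stub B holds VACUOUSLY**: then `C_EA = M`, every tuple from `C_EA` dies in the
quotient modulo `span_ℚ M = M`, so independence modulo `M` forces `n = 0`.  (Stub B with its
`sInf`s named; the registered verbatim form is `stub_calibB_vacuous` below.) -/
theorem periodGenericOverCore_of_pi_mem (hpi : (Real.pi : ℂ) ∈ kernelFreeCore) :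
    ∀ (n : ℕ) (x : Fin n → ℂ), (∀ i, x i ∈ logFreeCore) →
      LinearIndependent ℚ ((Submodule.span ℚ (kernelFreeCore : Set ℂ)).mkQ ∘ x) →
        (n : Cardinal) ≤ Algebra.trdeg ↥kernelFreeCore
          ↥(adjoin ↥kernelFreeCore (Set.range x ∪ Set.range (Complex.exp ∘ x))) := by
  intro n x hx hli
  have hCM : logFreeCore = kernelFreeCore := logFreeCore_eq_kernelFreeCore_iff.mpr hpi
  have hzero : ∀ i, ((Submodule.span ℚ (kernelFreeCore : Set ℂ)).mkQ ∘ x) i = 0 := fun i =>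
    mkQ_eq_zero_iff.mpr (hCM ▸ hx i)
  rcases Nat.eq_zero_or_pos n with rfl | hn
  · simp
  · exact absurd (hzero ⟨0, hn⟩) (hli.ne_zero ⟨0, hn⟩)

/-! ## (b) Stub B in rank `≤ 1` (bookkeeping) -/

/-- Over a relatively algebraically closed base `F`, an element outside `F` is transcendental
over `F` and gives `1 ≤ trdeg_F F(S)` for any `S ∋ a` (adapted from the line's
`relSchanuel_rank_one`). -/
theorem one_le_trdeg_adjoin_of_not_mem {F : IntermediateField ℚ ℂ}
    (hF : ∀ w : ℂ, IsAlgebraic F w → w ∈ F) {S : Set ℂ} {a : ℂ} (haS : a ∈ S) (haF : a ∉ F) :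
    (1 : Cardinal) ≤ Algebra.trdeg ↥F ↥(IntermediateField.adjoin ↥F S) := by
  let t : ↥(IntermediateField.adjoin ↥F S) := ⟨a, IntermediateField.subset_adjoin _ _ haS⟩
  have ht : Transcendental ↥F t := fun halg =>
    haF (hF _ (halg.algHom (IntermediateField.adjoin ↥F S).val))
  have hind : AlgebraicIndependent ↥F ![t] := algebraicIndependent_iff_transcendental.mpr ht
  simpa using hind.cardinalMk_le_trdeg

/-- **Stub B in rank `≤ 1` HOLDS** (bookkeeping): for `n = 1`, independence modulo `M` puts
`x 0` outside `M`, hence transcendental over the relatively algebraically closed field `M`, so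
`1 ≤ trdeg_M M(x, eˣ)`; `n = 0` is trivial.  Stub B (named `sInf`s) with `n ≤ 1` added. -/
theorem periodGenericOverCore_rank_le_one :
    ∀ (n : ℕ), n ≤ 1 → ∀ (x : Fin n → ℂ), (∀ i, x i ∈ logFreeCore) →
      LinearIndependent ℚ ((Submodule.span ℚ (kernelFreeCore : Set ℂ)).mkQ ∘ x) →
        (n : Cardinal) ≤ Algebra.trdeg ↥kernelFreeCore
          ↥(adjoin ↥kernelFreeCore (Set.range x ∪ Set.range (Complex.exp ∘ x))) := by
  intro n hn x _ hli
  rcases Nat.le_one_iff_eq_zero_or_eq_one.mp hn with rfl | rfl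
  · simp
  · have hx0 : x 0 ∉ kernelFreeCore := fun h0 => hli.ne_zero 0 (mkQ_eq_zero_iff.mpr h0)
    simpa using one_le_trdeg_adjoin_of_not_mem (F := kernelFreeCore)
      (fun _ hw => mem_kernelFreeCore_of_isAlgebraic hw) (Or.inl ⟨0, rfl⟩) hx0

/-! ## (c) The first open instance: `(2πi, (2πi)²)` and the transcendence of `e^{π²}` -/

/-- `(2πi)^2 = -4π²`. -/
theorem two_pi_I_sq : (2 * ↑Real.pi * I : ℂ) ^ 2 = -(4 * (Real.pi : ℂ) ^ 2) := by
  ring_nf; rw [Complex.I_sq]; ring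

/-- The test tuple `(2πi, (2πi)²)` lies in the log-free core. -/
theorem testTuple_mem_logFreeCore :
    ∀ i, ![(2 * ↑Real.pi * I : ℂ), (2 * ↑Real.pi * I) ^ 2] i ∈ logFreeCore := by
  intro i
  fin_cases i
  · exact two_pi_I_mem_logFreeCore
  · exact pow_mem two_pi_I_mem_logFreeCore 2

/-- KEY ALGEBRA: if a non-trivial rational combination `s·v + t·v²` of `v = 2πi` lies in `M`,
then `v ∈ M` (for `t ≠ 0`, `(2tv + s)² = 4t·(sv + tv²) + s² ∈ M`, so `2tv + s` is algebraic over
the relatively algebraically closed field `M`). -/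
theorem two_pi_I_mem_of_combination_mem {s t : ℚ} (hst : ¬(s = 0 ∧ t = 0))
    (h : (s : ℂ) * (2 * ↑Real.pi * I) + (t : ℂ) * (2 * ↑Real.pi * I) ^ 2 ∈ kernelFreeCore) :
    (2 * ↑Real.pi * I : ℂ) ∈ kernelFreeCore := by
  set v : ℂ := 2 * ↑Real.pi * I with hv
  have hsM : (s : ℂ) ∈ kernelFreeCore := SubfieldClass.ratCast_mem kernelFreeCore s
  have htM : (t : ℂ) ∈ kernelFreeCore := SubfieldClass.ratCast_mem kernelFreeCore t
  by_cases ht : t = 0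
  · have hs : s ≠ 0 := fun hs => hst ⟨hs, ht⟩
    subst ht
    have hs' : (s : ℂ) ≠ 0 := by exact_mod_cast hs
    have hv' : v = (s : ℂ)⁻¹ * ((s : ℂ) * v + ((0 : ℚ) : ℂ) * v ^ 2) := by
      push_cast; field_simp; ring
    rw [hv']
    exact mul_mem (inv_mem hsM) h
  · have ht' : (t : ℂ) ≠ 0 := by exact_mod_cast ht
    set w : ℂ := 2 * (t : ℂ) * v + s with hw
    have hw2 : w ^ 2 = 4 * (t : ℂ) * ((s : ℂ) * v + (t : ℂ) * v ^ 2) + (s : ℂ) ^ 2 := by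
      rw [hw]; ring
    have hw2M : w ^ 2 ∈ kernelFreeCore := by
      rw [hw2]
      exact add_mem (mul_mem (mul_mem (by norm_num [two_mem_kernelFreeCore, mul_mem]) htM) h)
        (pow_mem hsM 2)
    have hwalg : IsAlgebraic kernelFreeCore w :=
      IsAlgebraic.of_pow two_pos (isAlgebraic_algebraMap (⟨w ^ 2, hw2M⟩ : kernelFreeCore))
    have hwM : w ∈ kernelFreeCore := mem_kernelFreeCore_of_isAlgebraic hwalg
    have hv' : v = (w - s) / (2 * t) := by
      rw [hw]; field_simp; ring
    rw [hv']
    exact div_mem (sub_mem hwM hsM) (mul_mem two_mem_kernelFreeCore htM)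

/-- Under NoPi (`π ∉ M`) the test tuple `(2πi, (2πi)²)` is `ℚ`-linearly independent MODULO `M`. -/
theorem testTuple_linearIndependent_mod (hpi : (Real.pi : ℂ) ∉ kernelFreeCore) :
    LinearIndependent ℚ ((Submodule.span ℚ (kernelFreeCore : Set ℂ)).mkQ ∘
      ![(2 * ↑Real.pi * I : ℂ), (2 * ↑Real.pi * I) ^ 2]) := by
  have hfun : ((Submodule.span ℚ (kernelFreeCore : Set ℂ)).mkQ ∘
      ![(2 * ↑Real.pi * I : ℂ), (2 * ↑Real.pi * I) ^ 2]) =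
      ![(Submodule.span ℚ (kernelFreeCore : Set ℂ)).mkQ (2 * ↑Real.pi * I),
        (Submodule.span ℚ (kernelFreeCore : Set ℂ)).mkQ ((2 * ↑Real.pi * I) ^ 2)] := by
    ext i; fin_cases i <;> rfl
  rw [hfun, LinearIndependent.pair_iff]
  intro s t hst
  by_contra hne
  apply hpi
  rw [pi_mem_kernelFreeCore_iff]
  refine two_pi_I_mem_of_combination_mem hne ?_
  rw [← map_smul, ← map_smul, ← map_add, mkQ_eq_zero_iff] at hst
  simpa [Rat.smul_def] using hst

/-- From the rank-2 bound of stub B at the test tuple to ALGEBRAIC INDEPENDENCE over `M` of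
`2πi` and `e^{(2πi)²} = e^{−4π²}`: `M(2πi, −4π², e^{2πi} = 1, e^{−4π²}) = M(2πi, e^{−4π²})`, and a
pair generating a field of transcendence degree `≥ 2` is algebraically independent. -/
theorem algebraicIndependent_of_rank_two_bound
    (h2 : ((2 : ℕ) : Cardinal) ≤ Algebra.trdeg ↥kernelFreeCore
      ↥(IntermediateField.adjoin ↥kernelFreeCore
        (Set.range ![(2 * ↑Real.pi * I : ℂ), (2 * ↑Real.pi * I) ^ 2] ∪
          Set.range (Complex.exp ∘ ![(2 * ↑Real.pi * I : ℂ), (2 * ↑Real.pi * I) ^ 2])))) :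
    AlgebraicIndependent ↥kernelFreeCore
      ![(2 * ↑Real.pi * I : ℂ), Complex.exp ((2 * ↑Real.pi * I) ^ 2)] := by
  set v : ℂ := 2 * ↑Real.pi * I with hv
  set l : Fin 2 → ℂ := ![v, Complex.exp (v ^ 2)] with hl
  have hvl : v ∈ adjoin (↥kernelFreeCore) (Set.range l) := subset_adjoin _ _ ⟨0, by simp [hl]⟩
  have hel : Complex.exp (v ^ 2) ∈ adjoin (↥kernelFreeCore) (Set.range l) :=
    subset_adjoin _ _ ⟨1, by simp [hl]⟩
  have hle : adjoin (↥kernelFreeCore)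
      (Set.range ![v, v ^ 2] ∪ Set.range (Complex.exp ∘ ![v, v ^ 2])) ≤
      adjoin (↥kernelFreeCore) (Set.range l) := by
    rw [adjoin_le_iff]
    rintro w (⟨i, rfl⟩ | ⟨i, rfl⟩) <;> fin_cases i
    · simpa using hvl
    · simpa using pow_mem hvl 2
    · simp [hv, Complex.exp_two_pi_mul_I]
    · simpa using hel
  exact Literature.Barriers.Schanuel.algebraicIndependent_of_le_trdeg_adjoin l
    (h2.trans (trdeg_le_of_injective (inclusion hle) (inclusion_injective hle)))

/-- **Stub B contains an open transcendence statement.**  Under NoPi (`π ∉ M`, itself implied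
by stub A and by Schanuel's conjecture), stub B (named `sInf`s, as a hypothesis) at the test tuple
`(2πi, (2πi)²)` makes `2πi` and `e^{−4π²}` algebraically independent over the kernel-free core
`M` (which contains `ℚ̄`, `e`, `e^e`, `e^{√2}`, …). -/
theorem algebraicIndependent_two_pi_I_exp_of_periodGenericOverCore
    (hB : ∀ (n : ℕ) (x : Fin n → ℂ), (∀ i, x i ∈ logFreeCore) →
      LinearIndependent ℚ ((Submodule.span ℚ (kernelFreeCore : Set ℂ)).mkQ ∘ x) →
        (n : Cardinal) ≤ Algebra.trdeg ↥kernelFreeCore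
          ↥(adjoin ↥kernelFreeCore (Set.range x ∪ Set.range (Complex.exp ∘ x))))
    (hpi : (Real.pi : ℂ) ∉ kernelFreeCore) :
    AlgebraicIndependent ↥kernelFreeCore
      ![(2 * ↑Real.pi * I : ℂ), Complex.exp ((2 * ↑Real.pi * I) ^ 2)] :=
  algebraicIndependent_of_rank_two_bound
    (hB 2 _ testTuple_mem_logFreeCore (testTuple_linearIndependent_mod hpi))

/-- **Stub B ∧ NoPi ⟹ `e^{π²}` is transcendental** — the printed OPEN statement (Waldschmidt
2000 §1.4; tree: `Literature.Barriers.Schanuel.transcendental_exp_pi_sq_of_schanuel`, consequent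
open): `e^{−4π²} = (e^{π²})^{−4}` is transcendental over `M ⊇ ℚ̄`.  So stub B cannot be closed
without an `e^{π²}`-strength transcendence input.  (Registered verbatim form:
`stub_calibB_expPiSq` below.) -/
theorem transcendental_exp_pi_sq_of_periodGenericOverCore
    (hB : ∀ (n : ℕ) (x : Fin n → ℂ), (∀ i, x i ∈ logFreeCore) →
      LinearIndependent ℚ ((Submodule.span ℚ (kernelFreeCore : Set ℂ)).mkQ ∘ x) →
        (n : Cardinal) ≤ Algebra.trdeg ↥kernelFreeCore
          ↥(adjoin ↥kernelFreeCore (Set.range x ∪ Set.range (Complex.exp ∘ x))))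
    (hpi : (Real.pi : ℂ) ∉ kernelFreeCore) :
    Transcendental ℚ (Real.exp (Real.pi ^ 2)) := by
  intro halg
  have hind : AlgebraicIndependent ↥kernelFreeCore
      ![(2 * ↑Real.pi * I : ℂ), Complex.exp ((2 * ↑Real.pi * I) ^ 2)] :=
    algebraicIndependent_two_pi_I_exp_of_periodGenericOverCore hB hpi
  have htr : Transcendental ↥kernelFreeCore (Complex.exp ((2 * ↑Real.pi * I) ^ 2)) := by
    simpa using hind.transcendental 1
  apply htr
  -- `e^{π²} ∈ ℚ̄ ⊆ M`, hence `e^{(2πi)²} = ((e^{π²})⁻¹)^4 ∈ M`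
  have he : ((Real.exp (Real.pi ^ 2) : ℝ) : ℂ) ∈ kernelFreeCore :=
    mem_kernelFreeCore_of_isAlgebraic_rat halg.algebraMap
  have heq : Complex.exp ((2 * ↑Real.pi * I) ^ 2) =
      (((Real.exp (Real.pi ^ 2) : ℝ) : ℂ)⁻¹) ^ 4 := by
    rw [Complex.ofReal_exp, ← Complex.exp_neg, ← Complex.exp_nat_mul, two_pi_I_sq]
    push_cast
    ring_nf
  have hmem : Complex.exp ((2 * ↑Real.pi * I) ^ 2) ∈ kernelFreeCore := by
    rw [heq]; exact pow_mem (inv_mem he) 4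
  exact isAlgebraic_algebraMap (⟨_, hmem⟩ : ↥kernelFreeCore)

/-- The same in the form `e^{−4π²} ∉ ℚ̄` (the value of `exp` at `(2πi)² = −4π²`). -/
theorem transcendental_exp_neg_four_pi_sq_of_periodGenericOverCore
    (hB : ∀ (n : ℕ) (x : Fin n → ℂ), (∀ i, x i ∈ logFreeCore) →
      LinearIndependent ℚ ((Submodule.span ℚ (kernelFreeCore : Set ℂ)).mkQ ∘ x) →
        (n : Cardinal) ≤ Algebra.trdeg ↥kernelFreeCore
          ↥(adjoin ↥kernelFreeCore (Set.range x ∪ Set.range (Complex.exp ∘ x))))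
    (hpi : (Real.pi : ℂ) ∉ kernelFreeCore) :
    Transcendental ℚ (Complex.exp (-(4 * (Real.pi : ℂ) ^ 2))) := by
  intro halg
  have hind : AlgebraicIndependent ↥kernelFreeCore
      ![(2 * ↑Real.pi * I : ℂ), Complex.exp ((2 * ↑Real.pi * I) ^ 2)] :=
    algebraicIndependent_two_pi_I_exp_of_periodGenericOverCore hB hpi
  have htr : Transcendental ↥kernelFreeCore (Complex.exp ((2 * ↑Real.pi * I) ^ 2)) := by
    simpa using hind.transcendental 1
  rw [two_pi_I_sq] at htr
  exact htr (halg.tower_top kernelFreeCore)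

end CalibrationB

/-! ## The registered stubs -/

/-- **Registered stub `stub_calibB_vacuous` of line `generic-period-fibre`** (signature verbatim):
if `π ∈ M` then stub B — relative Schanuel of the log-free core `C_EA` over the kernel-free core
`M` — holds VACUOUSLY (`C_EA = M`, so no non-empty tuple from `C_EA` is `ℚ`-linearly independent
modulo `M`).  So B has content exactly when `π ∉ M` (open, implied by Schanuel's conjecture).
Proof: `CalibrationB.periodGenericOverCore_of_pi_mem` (`kernelFreeCore`, `logFreeCore` are these
`sInf`s by `rfl`). -/
theorem stub_calibB_vacuous :
    (Real.pi : ℂ) ∈ (sInf {K : IntermediateField ℚ ℂ | (∀ w ∈ K, Complex.exp w ∈ K) ∧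
        ∀ w : ℂ, IsAlgebraic K w → w ∈ K} : IntermediateField ℚ ℂ) →
    ∀ (n : ℕ) (x : Fin n → ℂ),
      (∀ i, x i ∈ (sInf {K : IntermediateField ℚ ℂ | (2 * ↑Real.pi * Complex.I : ℂ) ∈ K ∧
        (∀ w ∈ K, Complex.exp w ∈ K) ∧ ∀ w : ℂ, IsAlgebraic K w → w ∈ K} : IntermediateField ℚ ℂ)) →
      LinearIndependent ℚ ((Submodule.span ℚ ((sInf {K : IntermediateField ℚ ℂ |
        (∀ w ∈ K, Complex.exp w ∈ K) ∧ ∀ w : ℂ, IsAlgebraic K w → w ∈ K} :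
          IntermediateField ℚ ℂ) : Set ℂ)).mkQ ∘ x) →
        (n : Cardinal) ≤ Algebra.trdeg
          ↥(sInf {K : IntermediateField ℚ ℂ | (∀ w ∈ K, Complex.exp w ∈ K) ∧
            ∀ w : ℂ, IsAlgebraic K w → w ∈ K} : IntermediateField ℚ ℂ)
          ↥(IntermediateField.adjoin
            ↥(sInf {K : IntermediateField ℚ ℂ | (∀ w ∈ K, Complex.exp w ∈ K) ∧
              ∀ w : ℂ, IsAlgebraic K w → w ∈ K} : IntermediateField ℚ ℂ)
            (Set.range x ∪ Set.range (Complex.exp ∘ x))) :=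
  fun hpi => CalibrationB.periodGenericOverCore_of_pi_mem hpi

/-- **Registered stub `stub_calibB_expPiSq` of line `generic-period-fibre`** (signature verbatim):
stub B (as a hypothesis) together with `π ∉ M` implies that `e^{π²}` is TRANSCENDENTAL — a
printed open statement (Waldschmidt 2000 §1.4): B at the tuple `(2πi, (2πi)²) ⊂ C_EA`, which is
independent modulo `M` iff `π ∉ M`, makes `2πi, e^{−4π²}` algebraically independent over `M ⊇ ℚ̄`.
This calibrates stub B; it closes nothing.  Proof:
`CalibrationB.transcendental_exp_pi_sq_of_periodGenericOverCore`. -/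
theorem stub_calibB_expPiSq :
    (∀ (n : ℕ) (x : Fin n → ℂ),
      (∀ i, x i ∈ (sInf {K : IntermediateField ℚ ℂ | (2 * ↑Real.pi * Complex.I : ℂ) ∈ K ∧
        (∀ w ∈ K, Complex.exp w ∈ K) ∧ ∀ w : ℂ, IsAlgebraic K w → w ∈ K} : IntermediateField ℚ ℂ)) →
      LinearIndependent ℚ ((Submodule.span ℚ ((sInf {K : IntermediateField ℚ ℂ |
        (∀ w ∈ K, Complex.exp w ∈ K) ∧ ∀ w : ℂ, IsAlgebraic K w → w ∈ K} :
          IntermediateField ℚ ℂ) : Set ℂ)).mkQ ∘ x) →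
        (n : Cardinal) ≤ Algebra.trdeg
          ↥(sInf {K : IntermediateField ℚ ℂ | (∀ w ∈ K, Complex.exp w ∈ K) ∧
            ∀ w : ℂ, IsAlgebraic K w → w ∈ K} : IntermediateField ℚ ℂ)
          ↥(IntermediateField.adjoin
            ↥(sInf {K : IntermediateField ℚ ℂ | (∀ w ∈ K, Complex.exp w ∈ K) ∧
              ∀ w : ℂ, IsAlgebraic K w → w ∈ K} : IntermediateField ℚ ℂ)
            (Set.range x ∪ Set.range (Complex.exp ∘ x)))) →
    (Real.pi : ℂ) ∉ (sInf {K : IntermediateField ℚ ℂ | (∀ w ∈ K, Complex.exp w ∈ K) ∧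
        ∀ w : ℂ, IsAlgebraic K w → w ∈ K} : IntermediateField ℚ ℂ) →
      Transcendental ℚ (Real.exp (Real.pi ^ 2)) :=
  fun hB hpi => CalibrationB.transcendental_exp_pi_sq_of_periodGenericOverCore hB hpi

end Summit.Schanuel.Schanuel.Theorems.RigidCore

end
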